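import Mathlib
import Summits.NavierStokesRegularity.NavierStokesRegularity.Theorems.FrozenSignCascadeEnvelopeBoundSmallDataKernel
import HarnessLib

/-!
# Route FrozenSignCascade · crux `EnvelopeBound` (stmt-NavierStokesRegularity-1549): frequency
  localisation, I — the shell-to-tail bootstrap

Support file for the crux item stmt-NavierStokesRegularity-1549 (`EnvelopeBound`); lands
`--supports` that item (line `registered`; helper `envelopeBound_shellBootstrap` of the support
sub-goal `envelopeBound_of_shellSmallness`, whose continuity argument is in the companion file
`FrozenSignCascadeEnvelopeBoundShellSmallness`).

**Theorem (`envelopeBound_shellBootstrap`).** Let `V` be a Fourier-side mild solution on `[0,T]`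
(heat rate `c`), `t ∈ [0,T]`, and suppose that on `[0,t]` the slices obey a low-frequency sup
bound `‖V(s,ζ)‖ ≤ M` for `‖ζ‖ < R` and a critical envelope `‖ζ‖² ‖V(s,ζ)‖ ≤ Φ` for `‖ζ‖ ≥ R > 0`.
Then at every frequency `‖ξ‖ ≥ 2R`,
`‖ξ‖² ‖V(t,ξ)‖ ≤ ‖ξ‖² ‖V(0,ξ)‖ + (36π/c) · (8 M Φ |B_R| ‖ξ‖⁻¹ + 24 Φ² · 3|B₁|)`:
the Duhamel term beyond the doubled radius is LINEAR in the envelope with a coefficient decaying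
in `‖ξ‖` (the interaction with the low frequencies) plus QUADRATIC in the envelope with an absolute
coefficient (the scale-critical kernel `∫ ‖η‖⁻²‖ξ-η‖⁻² dη ≲ ‖ξ‖⁻¹` of the Le Jan–Sznitman theory).

Proof.
* `norm_fconv_le_of_shell`: the MIXED convolution bound
  `‖(v_j ⋆ v_k)(ξ)‖ ≤ 8 M Φ |B_R| ‖ξ‖⁻² + 24 Φ² · 3|B₁| · ‖ξ‖⁻¹` at `‖ξ‖ ≥ 2R` — symmetrisation
  over `‖ξ‖ ≤ 2‖η‖ ∨ ‖ξ‖ ≤ 2‖ξ-η‖` (`TightEnvelope.norm_le_two_mul_or`); on `‖ξ‖ ≤ 2‖η‖` (so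
  `‖η‖ ≥ R`) the factor at `η` carries `4Φ‖ξ‖⁻²`, against `M` on the ball `‖ξ-η‖ < R` (volume
  `|B_R|`) and against `Φ‖ζ‖⁻²` on `R ≤ ‖ζ‖ < ‖ξ‖`, `ζ = ξ-η` (ball integral `≤ 3|B₁|‖ξ‖`,
  `integral_ball_inv_norm_sq_le`), while for `‖ζ‖ ≥ ‖ξ‖` one has `‖η‖ ≤ 2‖ζ‖` and the product
  is `≤ 4Φ²‖η‖⁻⁴` on the tail `‖η‖ ≥ ‖ξ‖/2` (`integral_tail_inv_norm_four_le`).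
* `shell_bootstrap` / `envelopeBound_shellBootstrap`: Duhamel from `0`, `e^{-c‖ξ‖²t} ≤ 1` on the
  datum, the symbol bound `36π‖ξ‖` (`TightEnvelope.norm_nonlin_le_of_fconv_le`) and
  `c‖ξ‖² ∫₀ᵗ e^{-c‖ξ‖²(t-r)} dr ≤ 1` (`mul_norm_sq_mul_integral_heat_le`).

References: Y. Le Jan, A.-S. Sznitman, PTRF 109 (1997); P. G. Lemarié-Rieusset, *The
Navier–Stokes problem in the 21st century* (2016), §8.5, Thm. 8.19 / 8.21.
-/

noncomputable section

set_option linter.dupNamespace false -- nested layout Summit.<S>.<Sub>, Sub = S (D-0017)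

open MeasureTheory Set Metric Real Filter Topology
open Literature.Analysis.FluidPDE.FourierNS
open Summit.NavierStokesRegularity.NavierStokesRegularity.Theorems.TightEnvelope

namespace Summit.NavierStokesRegularity.NavierStokesRegularity.Theorems.EnvelopeBound.Registered

/-! ### The mixed convolution bound -/

/-- **The convolution at a high frequency under a low-frequency sup bound and a critical
envelope beyond.** If `‖v(ζ)‖ ≤ M` for `‖ζ‖ < R` and `‖ζ‖² ‖v(ζ)‖ ≤ Φ` for `‖ζ‖ ≥ R > 0`, then at
every frequency `‖ξ‖ ≥ 2R`,
`‖(v_j ⋆ v_k)(ξ)‖ ≤ 8 M Φ |B_R| ‖ξ‖⁻² + 24 Φ² · 3|B₁| · ‖ξ‖⁻¹`: symmetrise over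
`‖ξ‖ ≤ 2‖η‖ ∨ ‖ξ‖ ≤ 2‖ξ-η‖`; on `‖ξ‖ ≤ 2‖η‖` (so `‖η‖ ≥ R`) the factor at `η` carries
`4Φ‖ξ‖⁻²`, against `M` on the ball `‖ξ-η‖ < R` and against `Φ‖ζ‖⁻²` on `R ≤ ‖ζ‖ < ‖ξ‖`,
`ζ = ξ - η`, while for `‖ζ‖ ≥ ‖ξ‖` one has `‖η‖ ≤ 2‖ζ‖` and the product is `≤ 4Φ²‖η‖⁻⁴` on
`‖η‖ ≥ ‖ξ‖/2`. The pointwise bounds hold everywhere. -/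
theorem norm_fconv_le_of_shell {v : EuclideanSpace ℝ (Fin 3) → Fin 3 → ℂ} {M Φ R : ℝ}
    {ξ : EuclideanSpace ℝ (Fin 3)} (hM0 : 0 ≤ M) (hM : ∀ ζ, ‖ζ‖ < R → ‖v ζ‖ ≤ M) (hΦ0 : 0 ≤ Φ)
    (hΦ : ∀ ζ, R ≤ ‖ζ‖ → ‖ζ‖ ^ 2 * ‖v ζ‖ ≤ Φ) (hR : 0 < R) (hξ : 2 * R ≤ ‖ξ‖) (j k : Fin 3) :
    ‖fconv (v · j) (v · k) ξ‖ ≤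
      8 * M * Φ * (volume (ball (0 : EuclideanSpace ℝ (Fin 3)) R)).toReal * (‖ξ‖ ^ 2)⁻¹ +
        24 * Φ ^ 2 * (3 * (volume (ball (0 : EuclideanSpace ℝ (Fin 3)) 1)).toReal) * ‖ξ‖⁻¹ := by
  have hξ0 : 0 < ‖ξ‖ := by linarith
  set vB : ℝ := (volume (ball (0 : EuclideanSpace ℝ (Fin 3)) R)).toReal with hvB
  set CE : ℝ := 3 * (volume (ball (0 : EuclideanSpace ℝ (Fin 3)) 1)).toReal with hCE
  set S : Set (EuclideanSpace ℝ (Fin 3)) := {η | ‖ξ‖ / 2 ≤ ‖η‖} with hS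
  -- the three pieces of the majorant
  set C₁ : ℝ := 4 * M * Φ * (‖ξ‖ ^ 2)⁻¹ with hC₁
  set C₂ : ℝ := 4 * Φ ^ 2 * (‖ξ‖ ^ 2)⁻¹ with hC₂
  set C₃ : ℝ := 4 * Φ ^ 2 with hC₃
  have hC₁0 : 0 ≤ C₁ := by positivity
  have hC₂0 : 0 ≤ C₂ := by positivity
  have hC₃0 : 0 ≤ C₃ := by positivity
  set p : EuclideanSpace ℝ (Fin 3) → ℝ :=
    (ball (0 : EuclideanSpace ℝ (Fin 3)) R).indicator fun _ => (1 : ℝ) with hp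
  set q : EuclideanSpace ℝ (Fin 3) → ℝ :=
    (ball (0 : EuclideanSpace ℝ (Fin 3)) ‖ξ‖).indicator fun ζ => (‖ζ‖ ^ 2)⁻¹ with hq
  set w : EuclideanSpace ℝ (Fin 3) → ℝ := S.indicator fun η => (‖η‖ ^ 4)⁻¹ with hw
  set b : EuclideanSpace ℝ (Fin 3) → ℝ := fun η =>
    C₁ * p (ξ - η) + C₂ * q (ξ - η) + C₃ * w η with hb
  have hp0 : ∀ ζ, 0 ≤ p ζ := fun ζ => by
    simp only [hp]; exact Set.indicator_nonneg (fun _ _ => zero_le_one) _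
  have hq0 : ∀ ζ, 0 ≤ q ζ := fun ζ => by
    simp only [hq]; exact Set.indicator_nonneg (fun _ _ => by positivity) _
  have hw0 : ∀ η, 0 ≤ w η := fun η => by
    simp only [hw]; exact Set.indicator_nonneg (fun _ _ => by positivity) _
  have hb0 : ∀ η, 0 ≤ b η := fun η => by
    simp only [hb]
    have := hp0 (ξ - η); have := hq0 (ξ - η); have := hw0 η
    positivity
  -- the envelope as a pointwise bound beyond `R`
  have hv : ∀ ζ, R ≤ ‖ζ‖ → ‖v ζ‖ ≤ Φ * (‖ζ‖ ^ 2)⁻¹ := fun ζ hζ => by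
    have hζ0 : 0 < ‖ζ‖ := hR.trans_le hζ
    rw [← div_eq_mul_inv, le_div_iff₀ (by positivity), mul_comm]
    exact hΦ ζ hζ
  -- halving a norm costs a factor `4` on the inverse square
  have hinv : ∀ {a r : ℝ}, 0 < a → a ≤ 2 * r → (r ^ 2)⁻¹ ≤ 4 * (a ^ 2)⁻¹ := by
    intro a r ha har
    have h1 : (a / 2) ^ 2 ≤ r ^ 2 := pow_le_pow_left₀ (by positivity) (by linarith) 2
    calc (r ^ 2)⁻¹ ≤ ((a / 2) ^ 2)⁻¹ := inv_anti₀ (by positivity) h1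
      _ = 4 * (a ^ 2)⁻¹ := by rw [div_pow, inv_div, div_eq_mul_inv]; norm_num
  -- the key pointwise bound on the region `‖ξ‖ ≤ 2‖η‖`
  have hkey : ∀ η, ‖ξ‖ ≤ 2 * ‖η‖ → ‖v η‖ * ‖v (ξ - η)‖ ≤ b η := by
    intro η hη
    have hηR : R ≤ ‖η‖ := by linarith
    have hη0 : 0 < ‖η‖ := hR.trans_le hηR
    have hvη : ‖v η‖ ≤ Φ * (‖η‖ ^ 2)⁻¹ := hv η hηR
    have hvη' : ‖v η‖ ≤ 4 * Φ * (‖ξ‖ ^ 2)⁻¹ :=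
      calc ‖v η‖ ≤ Φ * (‖η‖ ^ 2)⁻¹ := hvη
        _ ≤ Φ * (4 * (‖ξ‖ ^ 2)⁻¹) := mul_le_mul_of_nonneg_left (hinv hξ0 hη) hΦ0
        _ = 4 * Φ * (‖ξ‖ ^ 2)⁻¹ := by ring
    have hb1 : 0 ≤ C₁ * p (ξ - η) := mul_nonneg hC₁0 (hp0 _)
    have hb2 : 0 ≤ C₂ * q (ξ - η) := mul_nonneg hC₂0 (hq0 _)
    have hb3 : 0 ≤ C₃ * w η := mul_nonneg hC₃0 (hw0 η)
    rcases lt_or_ge ‖ξ - η‖ R with h1 | h1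
    · -- `‖ξ - η‖ < R`: the low-frequency sup bound
      have hvζ : ‖v (ξ - η)‖ ≤ M := hM _ h1
      have hpζ : p (ξ - η) = 1 := by
        simp only [hp, indicator_of_mem (mem_ball_zero_iff.2 h1)]
      calc ‖v η‖ * ‖v (ξ - η)‖ ≤ (4 * Φ * (‖ξ‖ ^ 2)⁻¹) * M :=
            mul_le_mul hvη' hvζ (norm_nonneg _) (by positivity)
        _ = C₁ * p (ξ - η) := by rw [hpζ, hC₁]; ring
        _ ≤ b η := by simp only [hb]; linarith
    · have hvζ : ‖v (ξ - η)‖ ≤ Φ * (‖ξ - η‖ ^ 2)⁻¹ := hv _ h1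
      rcases lt_or_ge ‖ξ - η‖ ‖ξ‖ with h2 | h2
      · -- `R ≤ ‖ξ - η‖ < ‖ξ‖`: the ball piece of `‖ζ‖⁻²`
        have hqζ : q (ξ - η) = (‖ξ - η‖ ^ 2)⁻¹ := by
          simp only [hq, indicator_of_mem (mem_ball_zero_iff.2 h2)]
        calc ‖v η‖ * ‖v (ξ - η)‖ ≤ (4 * Φ * (‖ξ‖ ^ 2)⁻¹) * (Φ * (‖ξ - η‖ ^ 2)⁻¹) :=
              mul_le_mul hvη' hvζ (norm_nonneg _) (by positivity)
          _ = C₂ * q (ξ - η) := by rw [hqζ, hC₂]; ring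
          _ ≤ b η := by simp only [hb]; linarith
      · -- `‖ξ‖ ≤ ‖ξ - η‖`: then `‖η‖ ≤ 2‖ξ - η‖`, the tail piece on `‖η‖ ≥ ‖ξ‖/2`
        have hηS : η ∈ S := by
          simp only [hS, mem_setOf_eq]; linarith
        have hη2 : ‖η‖ ≤ 2 * ‖ξ - η‖ := by
          have := norm_le_norm_add_norm_sub ξ η
          linarith
        have hvζ' : ‖v (ξ - η)‖ ≤ Φ * (4 * (‖η‖ ^ 2)⁻¹) :=
          hvζ.trans (mul_le_mul_of_nonneg_left (hinv hη0 hη2) hΦ0)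
        have hwη : w η = (‖η‖ ^ 4)⁻¹ := by simp only [hw, indicator_of_mem hηS]
        have h4 : (‖η‖ ^ 4)⁻¹ = (‖η‖ ^ 2)⁻¹ * (‖η‖ ^ 2)⁻¹ := by
          rw [← mul_inv]; congr 1; ring
        calc ‖v η‖ * ‖v (ξ - η)‖ ≤ (Φ * (‖η‖ ^ 2)⁻¹) * (Φ * (4 * (‖η‖ ^ 2)⁻¹)) :=
              mul_le_mul hvη hvζ' (norm_nonneg _) (by positivity)
          _ = C₃ * w η := by rw [hwη, h4, hC₃]; ring
          _ ≤ b η := by simp only [hb]; linarith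
  -- the symmetrised pointwise bound, everywhere
  have hpt : ∀ η, ‖v η j * v (ξ - η) k‖ ≤ b η + b (ξ - η) := by
    intro η
    rw [norm_mul]
    have hjk : ‖v η j‖ * ‖v (ξ - η) k‖ ≤ ‖v η‖ * ‖v (ξ - η)‖ :=
      mul_le_mul (norm_le_pi_norm (v η) j) (norm_le_pi_norm (v (ξ - η)) k) (norm_nonneg _)
        (norm_nonneg _)
    refine hjk.trans ?_
    rcases norm_le_two_mul_or ξ η with h1 | h1
    · linarith [hkey η h1, hb0 (ξ - η)]
    · have h2 := hkey (ξ - η) h1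
      rw [sub_sub_cancel, mul_comm] at h2
      linarith [hb0 η]
  -- integrability of the majorant
  have hpInt : Integrable p :=
    (integrableOn_const (measure_ball_lt_top (x := (0 : EuclideanSpace ℝ (Fin 3)))
      (r := R)).ne).integrable_indicator measurableSet_ball
  have hqInt : Integrable q :=
    (integrableOn_inv_norm_sq_ball ‖ξ‖).integrable_indicator measurableSet_ball
  have hwInt : Integrable w := integrable_tail_inv_norm_four (by positivity : 0 < ‖ξ‖ / 2)
  have h1 : Integrable fun η => C₁ * p (ξ - η) := (hpInt.comp_sub_left ξ).const_mul C₁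
  have h2 : Integrable fun η => C₂ * q (ξ - η) := (hqInt.comp_sub_left ξ).const_mul C₂
  have h3 : Integrable fun η => C₃ * w η := hwInt.const_mul C₃
  have h12 : Integrable fun η => C₁ * p (ξ - η) + C₂ * q (ξ - η) := h1.add h2
  have hbInt : Integrable b := by
    simp only [hb]
    exact h12.add h3
  have hbInt' : Integrable fun η => b (ξ - η) := hbInt.comp_sub_left ξ
  -- the integral of the majorant
  have hIb : ∫ η, b η ≤ C₁ * vB + C₂ * (CE * ‖ξ‖) + C₃ * (CE * (‖ξ‖ / 2)⁻¹) := by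
    have e : ∫ η, b η = C₁ * (∫ η, p (ξ - η)) + C₂ * (∫ η, q (ξ - η)) + C₃ * ∫ η, w η := by
      simp only [hb]
      rw [integral_add h12 h3, integral_add h1 h2, integral_const_mul, integral_const_mul,
        integral_const_mul]
    rw [e, integral_sub_left_eq_self p volume ξ, integral_sub_left_eq_self q volume ξ]
    have hI1 : ∫ ζ, p ζ = vB := by
      rw [hp, integral_indicator_const (1 : ℝ) measurableSet_ball, smul_eq_mul, mul_one]
      rfl
    have hI2 : ∫ ζ, q ζ ≤ CE * ‖ξ‖ := integral_ball_inv_norm_sq_le hξ0.le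
    have hI3 : ∫ η, w η ≤ CE * (‖ξ‖ / 2)⁻¹ := integral_tail_inv_norm_four_le (by positivity)
    rw [hI1]
    gcongr
  have hIsum : ∫ η, (b η + b (ξ - η)) = 2 * ∫ η, b η := by
    rw [integral_add hbInt hbInt', integral_sub_left_eq_self b volume ξ]; ring
  calc ‖fconv (v · j) (v · k) ξ‖ = ‖∫ η, v η j * v (ξ - η) k‖ := by rw [fconv_apply]
    _ ≤ ∫ η, ‖v η j * v (ξ - η) k‖ := norm_integral_le_integral_norm _
    _ ≤ ∫ η, (b η + b (ξ - η)) :=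
        integral_mono_of_nonneg (Eventually.of_forall fun η => norm_nonneg _) (hbInt.add hbInt')
          (Eventually.of_forall hpt)
    _ = 2 * ∫ η, b η := hIsum
    _ ≤ 2 * (C₁ * vB + C₂ * (CE * ‖ξ‖) + C₃ * (CE * (‖ξ‖ / 2)⁻¹)) := by linarith [hIb]
    _ = 8 * M * Φ * vB * (‖ξ‖ ^ 2)⁻¹ + 24 * Φ ^ 2 * CE * ‖ξ‖⁻¹ := by
        rw [hC₁, hC₂, hC₃]
        field_simp
        ring

/-! ### The shell-to-tail bootstrap along a mild solution -/

variable {c T : ℝ} {V : ℝ → EuclideanSpace ℝ (Fin 3) → Fin 3 → ℂ}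

/-- **The pointwise bootstrap beyond the doubled radius.** For a Fourier-side mild solution on
`[0,T]` with `‖V(s,ζ)‖ ≤ M` on `‖ζ‖ < R` and `‖ζ‖²‖V(s,ζ)‖ ≤ Φ` on `‖ζ‖ ≥ R` for `s ∈ [0,t]`,
`t ∈ [0,T]`, at every frequency `‖ξ‖ ≥ 2R`:
`‖ξ‖²‖V(t,ξ)‖ ≤ ‖ξ‖²‖V(0,ξ)‖ + (36π/c)(8 M Φ |B_R| ‖ξ‖⁻¹ + 24 Φ² · 3|B₁|)` (Duhamel from `0`,
`e^{-c‖ξ‖²t} ≤ 1` on the datum, `norm_fconv_le_of_shell` with the symbol bound `36π‖ξ‖`, and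
`c‖ξ‖² ∫₀ᵗ e^{-c‖ξ‖²(t-r)} dr ≤ 1` on the Duhamel term). -/
theorem shell_bootstrap (h : IsFourierMild c 4 0 T V) {M Φ R t : ℝ} (ht : t ∈ Icc 0 T)
    (hR : 0 < R) (hM0 : 0 ≤ M) (hΦ0 : 0 ≤ Φ)
    (hM : ∀ s ∈ Icc 0 t, ∀ ζ : EuclideanSpace ℝ (Fin 3), ‖ζ‖ < R → ‖V s ζ‖ ≤ M)
    (hΦ : ∀ s ∈ Icc 0 t, ∀ ζ : EuclideanSpace ℝ (Fin 3), R ≤ ‖ζ‖ → ‖ζ‖ ^ 2 * ‖V s ζ‖ ≤ Φ)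
    {ξ : EuclideanSpace ℝ (Fin 3)} (hξ : 2 * R ≤ ‖ξ‖) :
    ‖ξ‖ ^ 2 * ‖V t ξ‖ ≤ ‖ξ‖ ^ 2 * ‖V 0 ξ‖ + 36 * π / c *
      (8 * M * Φ * (volume (ball (0 : EuclideanSpace ℝ (Fin 3)) R)).toReal * ‖ξ‖⁻¹ +
        24 * Φ ^ 2 * (3 * (volume (ball (0 : EuclideanSpace ℝ (Fin 3)) 1)).toReal)) := by
  have hc := h.hc
  have hξ0 : 0 < ‖ξ‖ := by linarith
  set vB : ℝ := (volume (ball (0 : EuclideanSpace ℝ (Fin 3)) R)).toReal with hvB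
  set CE : ℝ := 3 * (volume (ball (0 : EuclideanSpace ℝ (Fin 3)) 1)).toReal with hCE
  set X : ℝ := 8 * M * Φ * vB * (‖ξ‖ ^ 2)⁻¹ + 24 * Φ ^ 2 * CE * ‖ξ‖⁻¹ with hX
  have hX0 : 0 ≤ X := by positivity
  set N : ℝ := 36 * π * ‖ξ‖ * X with hN
  have hN0 : 0 ≤ N := by positivity
  have hNr : ∀ r ∈ Icc 0 t, ‖nonlin (V r) (V r) ξ‖ ≤ N := fun r hr =>
    norm_nonlin_le_of_fconv_le hX0 fun j k =>
      norm_fconv_le_of_shell hM0 (hM r hr) hΦ0 (hΦ r hr) hR hξ j k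
  -- Duhamel from time `0`
  set D : Fin 3 → ℂ := ∫ r in (0 : ℝ)..t, heat c ξ (t - r) • nonlin (V r) (V r) ξ with hD
  have hVt : V t ξ = heat c ξ (t - 0) • V 0 ξ - D := h.duhamel le_rfl ht.1 ht.2 ξ
  have hw0 : 0 < ‖ξ‖ ^ 2 := by positivity
  have h1 : ‖ξ‖ ^ 2 * ‖V t ξ‖ ≤ ‖ξ‖ ^ 2 * ‖V 0 ξ‖ + ‖ξ‖ ^ 2 * ‖D‖ := by
    rw [hVt]
    calc ‖ξ‖ ^ 2 * ‖heat c ξ (t - 0) • V 0 ξ - D‖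
        ≤ ‖ξ‖ ^ 2 * (‖heat c ξ (t - 0) • V 0 ξ‖ + ‖D‖) :=
          mul_le_mul_of_nonneg_left (norm_sub_le _ _) hw0.le
      _ = ‖ξ‖ ^ 2 * (heat c ξ (t - 0) * ‖V 0 ξ‖) + ‖ξ‖ ^ 2 * ‖D‖ := by
          rw [norm_heat_smul]; ring
      _ ≤ ‖ξ‖ ^ 2 * ‖V 0 ξ‖ + ‖ξ‖ ^ 2 * ‖D‖ := by
          gcongr
          exact mul_le_of_le_one_left (norm_nonneg _) (heat_le_one hc.le (by linarith [ht.1]) ξ)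
  -- the Duhamel term
  have hD1 : ‖D‖ ≤ ∫ r in (0 : ℝ)..t, heat c ξ (t - r) * ‖nonlin (V r) (V r) ξ‖ :=
    (intervalIntegral.norm_integral_le_integral_norm ht.1).trans_eq
      (intervalIntegral.integral_congr fun r _ => by simp only [norm_heat_smul])
  have hcont1 : Continuous fun r => heat c ξ (t - r) * ‖nonlin (V r) (V r) ξ‖ :=
    (continuous_heat_comp c continuous_const (continuous_const.sub continuous_id)).mul
      (h.continuous_nonlin_time ξ).norm
  have hcont2 : Continuous fun r => heat c ξ (t - r) * N :=
    (continuous_heat_comp c continuous_const (continuous_const.sub continuous_id)).mul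
      continuous_const
  have hD2 : ∫ r in (0 : ℝ)..t, heat c ξ (t - r) * ‖nonlin (V r) (V r) ξ‖ ≤
      ∫ r in (0 : ℝ)..t, heat c ξ (t - r) * N :=
    intervalIntegral.integral_mono_on ht.1 (hcont1.intervalIntegrable _ _)
      (hcont2.intervalIntegrable _ _) fun r hr =>
        mul_le_mul_of_nonneg_left (hNr r hr) (heat_nonneg _ _ _)
  have hheat : ∫ r in (0 : ℝ)..t, heat c ξ (t - r) ≤ (c * ‖ξ‖ ^ 2)⁻¹ := by
    have := mul_norm_sq_mul_integral_heat_le c ξ 0 t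
    rw [← one_div, le_div_iff₀' (by positivity)]
    exact this
  have hDle : ‖D‖ ≤ (c * ‖ξ‖ ^ 2)⁻¹ * N := by
    calc ‖D‖ ≤ _ := hD1
      _ ≤ _ := hD2
      _ = (∫ r in (0 : ℝ)..t, heat c ξ (t - r)) * N := intervalIntegral.integral_mul_const _ _
      _ ≤ (c * ‖ξ‖ ^ 2)⁻¹ * N := mul_le_mul_of_nonneg_right hheat hN0
  calc ‖ξ‖ ^ 2 * ‖V t ξ‖ ≤ ‖ξ‖ ^ 2 * ‖V 0 ξ‖ + ‖ξ‖ ^ 2 * ‖D‖ := h1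
    _ ≤ ‖ξ‖ ^ 2 * ‖V 0 ξ‖ + ‖ξ‖ ^ 2 * ((c * ‖ξ‖ ^ 2)⁻¹ * N) := by gcongr
    _ = ‖ξ‖ ^ 2 * ‖V 0 ξ‖ + 36 * π / c * (8 * M * Φ * vB * ‖ξ‖⁻¹ + 24 * Φ ^ 2 * CE) := by
        rw [hN, hX]
        field_simp

/-! ### The registered helper -/

/-- **The shell-to-tail bootstrap** (helper `envelopeBound_shellBootstrap` of the support
sub-goal `envelopeBound_of_shellSmallness`, explicit form of `shell_bootstrap`): for a
Fourier-side mild solution `V` on `[0,T]` with heat rate `c`, `t ∈ [0,T]`, a low-frequency sup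
bound `‖V(s,ζ)‖ ≤ M` on `‖ζ‖ < R` and a critical envelope `‖ζ‖²‖V(s,ζ)‖ ≤ Φ` on `‖ζ‖ ≥ R > 0` over
`[0,t]`, at every `‖ξ‖ ≥ 2R`:
`‖ξ‖²‖V(t,ξ)‖ ≤ ‖ξ‖²‖V(0,ξ)‖ + (36π/c)(8 M Φ |B_R| ‖ξ‖⁻¹ + 24 Φ² · 3|B₁|)`. -/
theorem envelopeBound_shellBootstrap :
    ∀ (c T : ℝ) (V : ℝ → EuclideanSpace ℝ (Fin 3) → Fin 3 → ℂ),
      Literature.Analysis.FluidPDE.FourierNS.IsFourierMild c 4 0 T V →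
      ∀ (M Φ R t : ℝ), t ∈ Set.Icc 0 T → 0 < R → 0 ≤ M → 0 ≤ Φ →
        (∀ s ∈ Set.Icc 0 t, ∀ ζ : EuclideanSpace ℝ (Fin 3), ‖ζ‖ < R → ‖V s ζ‖ ≤ M) →
        (∀ s ∈ Set.Icc 0 t, ∀ ζ : EuclideanSpace ℝ (Fin 3), R ≤ ‖ζ‖ →
            ‖ζ‖ ^ 2 * ‖V s ζ‖ ≤ Φ) →
        ∀ ξ : EuclideanSpace ℝ (Fin 3), 2 * R ≤ ‖ξ‖ →
          ‖ξ‖ ^ 2 * ‖V t ξ‖ ≤ ‖ξ‖ ^ 2 * ‖V 0 ξ‖ + 36 * Real.pi / c *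
            (8 * M * Φ * (MeasureTheory.volume
                (Metric.ball (0 : EuclideanSpace ℝ (Fin 3)) R)).toReal * ‖ξ‖⁻¹ +
              24 * Φ ^ 2 * (3 * (MeasureTheory.volume
                (Metric.ball (0 : EuclideanSpace ℝ (Fin 3)) 1)).toReal)) :=
  fun _ _ _ h _ _ _ _ ht hR hM0 hΦ0 hM hΦ _ hξ => shell_bootstrap h ht hR hM0 hΦ0 hM hΦ hξ

end Summit.NavierStokesRegularity.NavierStokesRegularity.Theorems.EnvelopeBound.Registered

end
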